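import Summits.AnomalousDissipation.AnomalousDissipation.Theorems.FloorCertificate.Negative.Uniform
import Literature.Analysis.FluidPDE.EnergySpaceRellich
import Literature.Analysis.FluidPDE.CylindricalGenerator
import Mathlib.MeasureTheory.Measure.Prokhorov

/-!
# Candidate proof of stub S3a `stub_cylindricalCombination` (line `dissipation-deficit-duality`)

drefute seat `refuter-drefute-stmt-AnomalousDissipation-14091-0`: a positive proof of S3a found while probing the
stub (attached as item evidence for the lead; NOT a refuter landing).

LINEAR COMBINATIONS OF CYLINDRICAL TEST FUNCTIONALS ARE REALISED ON EVERY BALL: concatenate the test fields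
(`Fin.append`), take the profile `χ · (a φ₁ ∘ π₁ + b φ₂ ∘ π₂)` with `χ` a `ContDiffBump` at `0` equal to `1`
on a ball containing the coordinate box of `{|u|² ≤ ρ}`.
-/

noncomputable section

set_option linter.dupNamespace false

namespace Summit.AnomalousDissipation.AnomalousDissipation.Cruxes.FloorCertificate.Drefute

open MeasureTheory Filter Topology UnitAddTorus Metric
open scoped InnerProductSpace ENNReal
open Literature.Analysis.FunctionSpaces Literature.Analysis.FluidPDE

variable {m₁ m₂ : ℕ}

/-- Restriction of coordinates to the first block. -/
def projL (m₁ m₂ : ℕ) : EuclideanSpace ℝ (Fin (m₁ + m₂)) →L[ℝ] EuclideanSpace ℝ (Fin m₁) :=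
  LinearMap.toContinuousLinearMap
    { toFun := fun z => WithLp.toLp 2 fun j => z (Fin.castAdd m₂ j)
      map_add' := fun z w => by ext j; simp
      map_smul' := fun c z => by ext j; simp }

/-- Restriction of coordinates to the second block. -/
def projR (m₁ m₂ : ℕ) : EuclideanSpace ℝ (Fin (m₁ + m₂)) →L[ℝ] EuclideanSpace ℝ (Fin m₂) :=
  LinearMap.toContinuousLinearMap
    { toFun := fun z => WithLp.toLp 2 fun k => z (Fin.natAdd m₁ k)
      map_add' := fun z w => by ext j; simp
      map_smul' := fun c z => by ext j; simp }

@[simp] theorem projL_apply (z : EuclideanSpace ℝ (Fin (m₁ + m₂))) (j : Fin m₁) :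
    projL m₁ m₂ z j = z (Fin.castAdd m₂ j) := rfl

@[simp] theorem projR_apply (z : EuclideanSpace ℝ (Fin (m₁ + m₂))) (k : Fin m₂) :
    projR m₁ m₂ z k = z (Fin.natAdd m₁ k) := rfl

theorem natAdd_ne_castAdd (j : Fin m₁) (k : Fin m₂) : Fin.natAdd m₁ k ≠ Fin.castAdd m₂ j := by
  intro h
  have := congrArg Fin.val h
  simp only [Fin.val_natAdd, Fin.val_castAdd] at this
  omega

theorem projL_single_castAdd (j : Fin m₁) :
    projL m₁ m₂ (EuclideanSpace.single (Fin.castAdd m₂ j) (1 : ℝ)) = EuclideanSpace.single j 1 := by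
  ext j'
  simp [Fin.castAdd_inj]

theorem projR_single_castAdd (j : Fin m₁) :
    projR m₁ m₂ (EuclideanSpace.single (Fin.castAdd m₂ j) (1 : ℝ)) = 0 := by
  ext k
  simp [natAdd_ne_castAdd j k]

theorem projL_single_natAdd (k : Fin m₂) :
    projL m₁ m₂ (EuclideanSpace.single (Fin.natAdd m₁ k) (1 : ℝ)) = 0 := by
  ext j
  simp [(natAdd_ne_castAdd j k).symm]

theorem projR_single_natAdd (k : Fin m₂) :
    projR m₁ m₂ (EuclideanSpace.single (Fin.natAdd m₁ k) (1 : ℝ)) = EuclideanSpace.single k 1 := by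
  ext k'
  simp [Fin.natAdd_inj]

/-- Coordinates of a state are bounded on balls: `‖coords u‖ ≤ √(Σᵢ (√(max ρ 0) ‖gᵢ‖)²)` for `|u|² ≤ ρ`. -/
theorem norm_coords_le (Φ : Torus.CylindricalTest (Fin 3)) {ρ : ℝ} {u : Torus.energySpace (Fin 3)}
    (hu : ‖u‖ ^ 2 ≤ ρ) :
    ‖Φ.coords u‖ ≤ Real.sqrt (∑ i, (Real.sqrt (max ρ 0) * ‖((Φ.g_smooth i).memLp 2).toLp (Φ.g i)‖) ^ 2) := by
  have hu' : ‖u‖ ≤ Real.sqrt (max ρ 0) := by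
    have h := Real.abs_le_sqrt (show ‖u‖ ^ 2 ≤ max ρ 0 from hu.trans (le_max_left _ _))
    rwa [abs_of_nonneg (norm_nonneg _)] at h
  have hsq : ‖Φ.coords u‖ ^ 2 ≤ ∑ i, (Real.sqrt (max ρ 0) * ‖((Φ.g_smooth i).memLp 2).toLp (Φ.g i)‖) ^ 2 := by
    rw [EuclideanSpace.norm_sq_eq]
    refine Finset.sum_le_sum fun i _ => ?_
    have hb : |Φ.coords u i| ≤ Real.sqrt (max ρ 0) * ‖((Φ.g_smooth i).memLp 2).toLp (Φ.g i)‖ := by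
      have h1 := Torus.abs_pairing_coe_le ((Φ.g_smooth i).memLp 2) u
      exact h1.trans (mul_le_mul_of_nonneg_right hu' (norm_nonneg _))
    have h0 : 0 ≤ Real.sqrt (max ρ 0) * ‖((Φ.g_smooth i).memLp 2).toLp (Φ.g i)‖ := by positivity
    rw [Real.norm_eq_abs]
    exact pow_le_pow_left₀ (abs_nonneg _) hb 2
  have h := Real.abs_le_sqrt hsq
  rwa [abs_of_nonneg (norm_nonneg _)] at h

/-- **S3a `stub_cylindricalCombination` (candidate proof).** -/
theorem cylindricalCombination :
    ∀ (ρ a b : ℝ) (Φ₁ Φ₂ : Torus.CylindricalTest (Fin 3)), ∃ Φ₀ : Torus.CylindricalTest (Fin 3),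
      ∀ u : Torus.energySpace (Fin 3), ‖u‖ ^ 2 ≤ ρ → Φ₀.grad u = a • Φ₁.grad u + b • Φ₂.grad u := by
  intro ρ a b Φ₁ Φ₂
  classical
  -- concatenated fields
  set g₀ : Fin (Φ₁.m + Φ₂.m) → UnitAddTorus (Fin 3) → EuclideanSpace ℝ (Fin 3) := Fin.append Φ₁.g Φ₂.g with hg₀
  have hg₀_smooth : ∀ i, Torus.IsSmooth (g₀ i) := fun i => by
    refine Fin.addCases (fun j => ?_) (fun k => ?_) i
    · simpa [hg₀] using Φ₁.g_smooth j
    · simpa [hg₀] using Φ₂.g_smooth k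
  have hg₀_div : ∀ i, Torus.IsDivFree (g₀ i) := fun i => by
    refine Fin.addCases (fun j => ?_) (fun k => ?_) i
    · simpa [hg₀] using Φ₁.g_divFree j
    · simpa [hg₀] using Φ₂.g_divFree k
  have hg₀_mean : ∀ i, Torus.HasZeroMean (g₀ i) := fun i => by
    refine Fin.addCases (fun j => ?_) (fun k => ?_) i
    · simpa [hg₀] using Φ₁.g_zeroMean j
    · simpa [hg₀] using Φ₂.g_zeroMean k
  -- radius of the coordinate box
  set S : ℝ := ∑ i, (Real.sqrt (max ρ 0) * ‖((hg₀_smooth i).memLp 2).toLp (g₀ i)‖) ^ 2 with hS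
  set R : ℝ := Real.sqrt S + 1 with hR
  have hRpos : 0 < R := by positivity
  let χ : ContDiffBump (0 : EuclideanSpace ℝ (Fin (Φ₁.m + Φ₂.m))) := ⟨R, R + 1, hRpos, by linarith⟩
  -- the profile
  set ψ : EuclideanSpace ℝ (Fin (Φ₁.m + Φ₂.m)) → ℝ :=
    fun z => a * Φ₁.φ (projL Φ₁.m Φ₂.m z) + b * Φ₂.φ (projR Φ₁.m Φ₂.m z) with hψ
  set φ₀ : EuclideanSpace ℝ (Fin (Φ₁.m + Φ₂.m)) → ℝ := fun z => χ z * ψ z with hφ₀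
  have hψC : ContDiff ℝ 1 ψ :=
    (contDiff_const.mul (Φ₁.φ_contDiff.comp (projL Φ₁.m Φ₂.m).contDiff)).add
      (contDiff_const.mul (Φ₂.φ_contDiff.comp (projR Φ₁.m Φ₂.m).contDiff))
  have hφ₀C : ContDiff ℝ 1 φ₀ := χ.contDiff.mul hψC
  have hφ₀K : HasCompactSupport φ₀ := χ.hasCompactSupport.mul_right
  -- the combined functional
  let Φ₀ : Torus.CylindricalTest (Fin 3) :=
    ⟨Φ₁.m + Φ₂.m, g₀, hg₀_smooth, hg₀_div, hg₀_mean, φ₀, hφ₀C, hφ₀K⟩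
  refine ⟨Φ₀, fun u hu => ?_⟩
  -- coordinates of `u` in the three functionals
  have hcL : projL Φ₁.m Φ₂.m (Φ₀.coords u) = Φ₁.coords u := by
    ext j
    simp [Torus.CylindricalTest.coords, Φ₀, hg₀]
  have hcR : projR Φ₁.m Φ₂.m (Φ₀.coords u) = Φ₂.coords u := by
    ext k
    simp [Torus.CylindricalTest.coords, Φ₀, hg₀]
  -- the bump is `1` near `coords₀ u`
  have hball : Φ₀.coords u ∈ ball (0 : EuclideanSpace ℝ (Fin (Φ₁.m + Φ₂.m))) χ.rIn := by
    rw [mem_ball, dist_zero_right]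
    have h := norm_coords_le Φ₀ hu
    change ‖Φ₀.coords u‖ ≤ Real.sqrt S at h
    change ‖Φ₀.coords u‖ < R
    linarith
  have hev : φ₀ =ᶠ[𝓝 (Φ₀.coords u)] ψ := by
    filter_upwards [χ.eventuallyEq_one_of_mem_ball hball] with z hz
    have hz' : (χ : EuclideanSpace ℝ (Fin (Φ₁.m + Φ₂.m)) → ℝ) z = 1 := hz
    simp only [hφ₀, hz', one_mul]
  -- derivative of the profile at `coords₀ u`
  have hd1 : HasFDerivAt (fun z => Φ₁.φ (projL Φ₁.m Φ₂.m z))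
      ((fderiv ℝ Φ₁.φ (projL Φ₁.m Φ₂.m (Φ₀.coords u))).comp (projL Φ₁.m Φ₂.m)) (Φ₀.coords u) :=
    ((Φ₁.φ_contDiff.differentiable one_ne_zero) _).hasFDerivAt.comp _ (projL Φ₁.m Φ₂.m).hasFDerivAt
  have hd2 : HasFDerivAt (fun z => Φ₂.φ (projR Φ₁.m Φ₂.m z))
      ((fderiv ℝ Φ₂.φ (projR Φ₁.m Φ₂.m (Φ₀.coords u))).comp (projR Φ₁.m Φ₂.m)) (Φ₀.coords u) :=
    ((Φ₂.φ_contDiff.differentiable one_ne_zero) _).hasFDerivAt.comp _ (projR Φ₁.m Φ₂.m).hasFDerivAt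
  have hdψ : HasFDerivAt ψ
      (a • (fderiv ℝ Φ₁.φ (projL Φ₁.m Φ₂.m (Φ₀.coords u))).comp (projL Φ₁.m Φ₂.m) +
        b • (fderiv ℝ Φ₂.φ (projR Φ₁.m Φ₂.m (Φ₀.coords u))).comp (projR Φ₁.m Φ₂.m)) (Φ₀.coords u) :=
    (hd1.const_mul a).add (hd2.const_mul b)
  have hfd : fderiv ℝ Φ₀.φ (Φ₀.coords u) =
      a • (fderiv ℝ Φ₁.φ (Φ₁.coords u)).comp (projL Φ₁.m Φ₂.m) +
        b • (fderiv ℝ Φ₂.φ (Φ₂.coords u)).comp (projR Φ₁.m Φ₂.m) := by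
    change fderiv ℝ φ₀ (Φ₀.coords u) = _
    rw [hev.fderiv_eq, hdψ.fderiv, hcL, hcR]
  -- assemble the differential
  funext x
  change (∑ i, (fderiv ℝ Φ₀.φ (Φ₀.coords u) (EuclideanSpace.single i 1)) • Φ₀.g i x) =
    a • (∑ j, (fderiv ℝ Φ₁.φ (Φ₁.coords u) (EuclideanSpace.single j 1)) • Φ₁.g j x) +
      b • (∑ k, (fderiv ℝ Φ₂.φ (Φ₂.coords u) (EuclideanSpace.single k 1)) • Φ₂.g k x)
  rw [Fin.sum_univ_add, hfd]
  simp only [FunLike.coe_add, FunLike.coe_smul, Pi.add_apply, Pi.smul_apply,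
    ContinuousLinearMap.comp_apply, smul_eq_mul, Finset.smul_sum, ← mul_smul]
  congr 1
  · refine Finset.sum_congr rfl fun j _ => ?_
    rw [projL_single_castAdd, projR_single_castAdd, map_zero, mul_zero, add_zero]
    simp [Φ₀, hg₀]
  · refine Finset.sum_congr rfl fun k _ => ?_
    rw [projL_single_natAdd, projR_single_natAdd, map_zero, mul_zero, zero_add]
    simp [Φ₀, hg₀]

end Summit.AnomalousDissipation.AnomalousDissipation.Cruxes.FloorCertificate.Drefute

end
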